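import Summits.BirchSwinnertonDyer.BirchSwinnertonDyer.Theorems.SchneiderFreeAdditiveX3GordCellThreeAnomalous
import Summits.BirchSwinnertonDyer.BirchSwinnertonDyer.Theorems.SchneiderFreeAdditiveX3GordCellThreePerPair
import Summits.BirchSwinnertonDyer.BirchSwinnertonDyer.Theorems.SchneiderFreeAdditiveX3UpperGordCellThreeAnomalousOfPartnerClass
import HarnessLib

/-!
# Route `SchneiderFreeAdditiveX3` (K1 door) on the (G-ord, `e = 2`) cell AT `p = 3`, PER PAIR, for the pairs with an ANOMALOUS twist (1 725 of 2 411):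
# the LOWER half of BSD₃, `MissingPPartAt W 3`, Miller's `BSD(E, 3)` and crux r3's own currency from PUBLISHED facts ∪ {[DIV.dvd], the typed
# analytic count, [RH], [PWL-θ]} for every Keller–Yin-normalised curve; and THE WHOLE CELL AT `p = 3` (NAT ∨ anomalous) in one statement

Cell `bsd-schneider-ideate`, seat `bsd-schneider-door-c5` (prover, generation 32; assembly layer; `--supports` 19177).
PARTITION: board row B6 ∩ X3 ∩ sst-twist, `r = 1`, (G-ord, `e = 2`) half at `p = 3` (2 411 pairs: 686 NAT — generation 27 — and 1 725 ANOMALOUS —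
this file) of `Rank1Residual.partition` — PER-PAIR ASSEMBLY on top of FILE 14 (`KYBranchThreeAnomalousDoor`); types-the-object-of nothing; closes none
of B6's cells (BSD NOT advanced).  bears_on: K1-door (19177 r3 `GordTwoBranchIMC`; FYI wing 20365).  FILE 15 of the anomalous-twin port.

WHAT (generation 27's `KYBranchThreePerPair` VERBATIM with the non-anomalous clause `hna` replaced by «an anomalous good-ordinary twist model +
Keller–Yin's ∀-normalisation» and the NAT inputs [AN3]/[BR3]/CGLS Props. 1.2.5, 14, Cor. 1.2.6 replaced by the hna-free count
`thm351_anacong_branch_three_allTwists`, [RH], [PWL-θ] and the four published [BR] facts; Greenberg 2006 Prop. 4.2 / §5 A are the tree's theorems).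
* §1 `missingLowerBoundAt_gordTwo_three_anomalous` — LOWER half per pair (`ord₃ #Ш(E)_an ≤ ord₃ #Ш(E)`): the Heegner/twist datum with `d_K ≡ 1 (mod 8)`,
  STEP L at it from FILE 14's per-datum door + the CLOSED control corner + Kolyvagin, then `JointLowerManin` / `PartnerUpperRankZero`.
* §2 `missingPPartAt_gordTwo_three_anomalous`, `bsdp_gordTwo_three_anomalous` — with generation 29's UPPER half on the whole cell from the TU datum
  (`UpperThreeAnomalousOfPartnerClass.missingUpperBoundAt_gordTwo_three_…`, ⟸ PUB ∪ {[DIV.dvd], CGLS Prop. 14, [RH], [PWL-θ]} ∪ {TU}).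
* §3 `additiveIMCLowerBDPInputManinAt_gordTwo_three_anomalous` — crux r3's conclusion `AdditiveIMCLowerBDPInputManinAt W 3` for every such pair
  (the `d_K = −3` sliver is void at `p = 3`).
* §4 **`additiveIMCLowerBDPInputManinAt_gordTwo_three_of_normalised`** — THE WHOLE (G-ord, `e = 2`) CELL AT `p = 3`: crux r3's conclusion for EVERY
  globally minimal `W` with `r_an = 1`, `ClassX3 W 3`, `SubGordTwo W 3` and the ∀-normalisation «every rational `3`-line of `W` is `D₃`-non-trivial»
  (automatic on the NAT pairs; Keller–Yin 2410.23241's standing choice of lattice on the anomalous ones), by the dichotomy NAT ∨ anomalous model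
  (`UpperThreeAnomalousOfPartnerClass.forall_twist_not_anomalous_or_exists_anomalous_twist`): generation 27 on the first branch, §3 on the second.

INPUT LEDGER PER PAIR, (G-ord, `e = 2`), `p = 3`, ANOMALOUS: PUBLISHED facts (typed, by name: `PrintedFacts`, Hsieh A, LZZ, Castella–Hsieh signed, CGLS
Thm. 2.1.2, Greenberg 2016 Props. 2.6.3/4.1.1, Greenberg 2006 Props. 3.2/4.1 (+ 4.2/§5 A tree theorems), Bleher et al. 3.3.1, de Shalit II.6.4, Hida
Thm. I) ∪ {[DIV.dvd] (PREPRINT), `thm351_anacong_branch_three_allTwists` (PREPRINT sentence, PUB-composed at `p = 3`, audit pending), [RH], [PWL-θ]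
(bsd-eis typed)} ∪ {the pair's TU certificate (upper half only)}.  Per-LATTICE hypothesis: the ∀-normalisation (the KY-normalised member of the class;
certified per pair, kit j323864: 1 725 / 1 725).

HONEST FRAMING: THEOREMS ONLY; pure composition of tree theorems, CONDITIONAL on the displayed hypotheses; [DIV.dvd] and the count are unrefereed
PREPRINT sentences (the count PUB-composed at `p = 3`, audit pending); nothing is closed by me; BSD is proved for no curve — per pair this is BSD₃
MODULO {published theorems} ∪ {[DIV.dvd], the count, [RH], [PWL-θ]} ∪ {TU}; «closes rung: none».  References: [KellerYin2024b] Thm. 3.3.6, Prop.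
3.4.4, Thm. 3.5.1; [KellerYin2024] Thms. 1.2.2, 1.4.1, 2.2.2, 2.2.3, Prop. 1.2.5; [CastellaGrossiLeeSkinner2022] Thms. 2.1.2, 2.2.2, Prop. 14;
[CastellaHsieh2018] §3.3; [Hsieh2014] Thm. A; [LiuZhangZhang2018]; [Miller2011LMS] Def. 1.1; [GrossZagier1986] I.(6.3); [FriedbergHoffstein1995]
Thm. B; this seat p726273 (F14), p684792/p685637 (gen 27 templates), p698824 (gen 29 upper).
-/

set_option autoImplicit false
-- `Summit.<P>.<Sub>` repeats `BirchSwinnertonDyer` by the tree's layout convention (D-0017)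
set_option linter.dupNamespace false

noncomputable section

open scoped Classical NumberField

open Field NumberField IsDedekindDomain WeierstrassCurve
  Literature.NumberTheory.EllipticCurves Literature.NumberTheory.EllipticCurves.GreenbergSelmer
  Literature.NumberTheory.GaloisRepresentations Literature.NumberTheory.GaloisCohomology
  Literature.NumberTheory.EllipticCurves.ModularForms Literature.NumberTheory.EllipticCurves.Rank1Residual
  Literature.NumberTheory.EllipticCurves.Rank1Residual.Typed
  Literature.NumberTheory.EllipticCurves.KellerYin2024 Literature.NumberTheory.EllipticCurves.CaiShuTian2014
  Literature.NumberTheory.IwasawaTheory Literature.NumberTheory.IwasawaTheory.Greenberg2016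
  Literature.NumberTheory.IwasawaTheory.Greenberg2006
  Literature.NumberTheory.EllipticCurves.Rubin1991 Literature.NumberTheory.EllipticCurves.DeShalit1987
  Literature.NumberTheory.EllipticCurves.Hida2010MuInvariant Literature.NumberTheory.EllipticCurves.BCGKPST2020
  Summit.BirchSwinnertonDyer.Rank1Residual Summit.BirchSwinnertonDyer.Rank1Residual.X11b
  Summit.BirchSwinnertonDyer.Rank1Residual.X11b.AcSelmer Summit.BirchSwinnertonDyer.Rank1Residual.X11b.Halves
  Summit.BirchSwinnertonDyer.BirchSwinnertonDyer.Theorems.SchneiderFree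
  Summit.BirchSwinnertonDyer.BirchSwinnertonDyer.Theorems.SchneiderFree.Upper
  Summit.BirchSwinnertonDyer.BirchSwinnertonDyer.Theorems.SchneiderFree.KYRead
  Summit.BirchSwinnertonDyer.BirchSwinnertonDyer.Theses.SchneiderFreeAdditiveX3
  Summit.BirchSwinnertonDyer.BirchSwinnertonDyer.Theorems.SchneiderFreeAdditiveX3.ControlDischarged
  Summit.BirchSwinnertonDyer.BirchSwinnertonDyer.Theorems.SchneiderFreeAdditiveX3.KYBranchOnly
  Summit.BirchSwinnertonDyer.BirchSwinnertonDyer.Theorems.SchneiderFreeAdditiveX3.KYBranchThreeAux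
  Summit.BirchSwinnertonDyer.BirchSwinnertonDyer.Theorems.SchneiderFreeAdditiveX3.KYBranchThreePerPair
  Summit.BirchSwinnertonDyer.BirchSwinnertonDyer.Theorems.SchneiderFreeAdditiveX3.KYBranchThreeAnomalousDoor
  Summit.BirchSwinnertonDyer.BirchSwinnertonDyer.Theorems.SchneiderFreeAdditiveX3.UpperThreeAnomalousOfPartnerClass
open Literature.NumberTheory.EllipticCurves.CastellaGrossiLeeSkinner2022
  (prop14_residualCharacterSelmer_finite thm212_exists_isKatzLFunction prop125_characterGrSelmerDual_torsion_muZero_dim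
    cor126_residualCharacter_globalLift cor126_residualCharacter_localSurjective)
open Literature.NumberTheory.EllipticCurves.KellerYin2024 (thm122_rubinHida_residualPair_unrSelmer prop125_residualPair_unrSelmer_imprimitive
  thm351_anacong_branch_three_allTwists)

namespace Summit.BirchSwinnertonDyer.BirchSwinnertonDyer.Theorems.SchneiderFreeAdditiveX3.KYBranchThreeAnomalousPerPair

/-! ### §1 The LOWER half per pair on (G-ord, `e = 2`) at `p = 3`, anomalous twist, Keller–Yin-normalised curve -/

/-- **LOWER half per pair on the (G-ord, `e = 2`) cell AT `p = 3` for a pair with an ANOMALOUS twist model, Keller–Yin-normalised ⇐ `PrintedFacts` ∧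
Hsieh 2014 Thm. A ∧ Liu–Zhang–Zhang 2018 ∧ Castella–Hsieh signed ∧ [DIV.dvd] (PREPRINT) ∧ the typed hna-free analytic count ∧ CGLS Thm. 2.1.2 ∧ [RH] ∧
[PWL-θ] ∧ the published facts — NO crux, NO Keller–Yin Thm. 3.5.1 sentence.**  For every globally minimal `W/ℚ` with `r_an = 1`, `ClassX3 W 3`,
`SubGordTwo W 3`, an anomalous good-ordinary twist model `W = C • V^{(3*)}` (`3 ∣ a₃(V) − 1`) and the ∀-normalisation: `MissingLowerBoundAt W 3`.
Generation 27's proof: the Heegner/twist datum with `d_K ≡ 1 (mod 8)` (Friedberg–Hoffstein; `d_K ≠ −3`), STEP L at it from FILE 14's per-datum door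
`KYBranchThreeAnomalousDoor.additiveIMCLowerBDPOnTree_subGordTwo_three_offSliver_anomalous_self` + the control inequality (CLOSED corner + Kolyvagin),
`Ш(E/K)` finite by Kolyvagin, then `JointLowerManin` / `PartnerUpperRankZero`.  CONDITIONAL on the displayed hypotheses; closes no item; BSD not advanced.
[claim: KellerYin2024PotOrd, status: under-review]
[cite: KellerYin2024b, Thm. 3.3.6 and Prop. 3.4.4 (arXiv:2410.23241 p. 19) (preprint; the Kolyvagin divisibility a hypothesis), §3.5]
[cite: KellerYin2024, Thms. 1.2.2, 1.4.1, 2.2.2, 2.2.3, Prop. 1.2.5 (arXiv:2402.12781v2)] [cite: CastellaGrossiLeeSkinner2022, Thms. 2.1.2, 2.2.2]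
[cite: JetchevSkinnerWan2017, §7.4.1 (arXiv:1512.06894 p. 30)] [cite: FriedbergHoffstein1995, Thm. B] [cite: GrossZagier1986, Thm. I.(6.3) and (7.3)] -/
theorem missingLowerBoundAt_gordTwo_three_anomalous (hF : PrintedFacts)
    (hA : Hsieh2014.thmA_exists_isHsiehLFunction_unrPeriod_anyLevel)
    (hL : LiuZhangZhang2018.thm151_thm153_modularCurve_heegnerVector_additive)
    (hCHσ : castellaHsieh2018_exists_isBranchBDPLFunction_signed)
    (hDVD : thm336_dvd_branch_OPEN) (hAN : thm351_anacong_branch_three_allTwists) (h212 : thm212_exists_isKatzLFunction)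
    (hRH : thm122_rubinHida_residualPair_unrSelmer) (hPWL : prop125_residualPair_unrSelmer_imprimitive)
    (h331 : thm331_rubin_exists_katzMeasure₂_pseudoIso_span_eq) (h411 : prop411_selmer_isAlmostDivisible)
    (hFE : thmII64_katzMeasure₂_functionalEquation) (hO1 : thmI_mu_katzBranch_reflect_eq_zero)
    (h263 : prop263_sur_of_crk) (h41 : prop41_globalEulerPoincareCorank) (h32 : prop32_cohomology_isCofinitelyGenerated) :
    ∀ (W : WeierstrassCurve ℚ) [W.IsElliptic] [W.IsGloballyMinimal],
      W.analyticRank = 1 → ClassX3 W 3 → Additive.SubGordTwo W 3 →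
      ∀ (V : WeierstrassCurve ℚ) [V.IsElliptic] [V.IsGloballyMinimal] (CV : VariableChange ℚ),
        GoodOrd V 3 → (3 : ℤ) ∣ V.frobeniusTrace 3 - 1 → CV • V.quadraticTwist ((-1 : ℚ) ^ (3 / 2) * (3 : ℕ)) = W →
      (∀ Φ : AddSubgroup (geomTorsion W ((3 : ℕ) : ℤ)), IsRationalLine W 3 Φ → ¬ LineDecompositionTrivialAt W 3 Φ) →
      MissingLowerBoundAt W 3 := by
  have hJ : JointLowerManin := schneiderFreeAdditiveX3_jointLowerManin_proof
  have hU : PartnerUpperRankZero := schneiderFreeAdditiveX3_partnerUpperRankZero_proof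
  obtain ⟨hGZ, hKo, hGZK, hmod, hmodD, hCas, hGZ73, hFH, hpar, hHP, hDel, hW16, hWu⟩ := hF
  intro W _ _ hr hX hG V _ _ CV hV ha hCV hnorm
  have hp2 : (3 : ℕ) ≠ 2 := by norm_num
  have hS : Additive.SubSemistableTwist W 3 := Or.inr hG
  -- the Heegner/twist datum with `d_K ≡ 1 (mod 8)`
  obtain ⟨N, _, K, _, _, Dt, H, ι, P, Wd, _, _, hN, hKiq, hodd, hunit, hHe, hLtw, hP, hnt, hWd, hrd, hXd, hSd, h8⟩ :=
    exists_heegnerTwistDataManin_discr_emod_eight hFH hpar hHP hGZ hmod W 3 hr hp2 hX hS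
  have hdK : NumberField.discr K ≠ -3 := discr_ne_neg_three_of_emod_eight h8
  have hloc : Additive.N10.Locus W 3 :=
    (Additive.N10.locus_iff_cells W 3).mpr
      ((Additive.N10.cellM_or_cellGordTwo_of_classX3_of_subSemistableTwist W 3 hp2 hX hS).elim Or.inl
        (fun h ↦ Or.inr (Or.inl h)))
  -- STEP L at THIS datum
  have hfin : (W.baseChange K).ShaFinite := (hKo N W K hKiq hHe ⟨Dt, H, ι, hP⟩ hnt).2
  have hidx : IndexLowerBoundLeAt W 3 K P (padicValNat 3 Dt.c.natAbs) := by
    refine indexLowerBoundLeAt_of_frames_of_shaFinite_le hloc hN hKiq hHe hfin ?_ ?_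
    · intro κ hκ γ _ 𝔭 h𝔭 he hf
      exact additiveIMCLowerBDPOnTree_subGordTwo_three_offSliver_anomalous_self hKo hmodD hA hL hCHσ hDVD hAN h212 hRH hPWL h331 h411 hFE hO1
        h263 h41 Greenberg2006.prop42_localEulerPoincareCorank_holds Greenberg2006.sec5A_localH2_subsingleton_of_LOC1_holds h32 W hr hX hG V
        CV hV ha hCV hnorm N K Dt H ι P hr hloc hN hKiq hodd hunit hHe hLtw hP hnt hdK κ hκ γ 𝔭 h𝔭 he hf
    · intro κ hκ γ _ 𝔭 h𝔭 he hf
      exact additiveControlLeOnTreeAt_of_pt_of_kolyvagin pt_selmer_forall hKo W 3 hr hp2 hX hS N K Dt H ι P hr hloc hN hKiq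
        hodd hunit hHe hLtw hP hnt κ hκ γ 𝔭 h𝔭 he hf
  have hJ' : JointLowerBoundAt W Wd 3 :=
    hJ hGZ hKo hGZK hmod hmodD hCas hGZ73 W 3 N K Dt H ι P Wd hr hN hKiq hodd hunit hHe hLtw hP hnt hWd hrd hp2 hidx
  exact missingLowerBoundAt_of_joint_of_upper hJ' (hU hDel hGZK hmod hmodD hW16 hWu Wd 3 hrd hp2 hXd hSd)

/-! ### §2 Both halves per pair at `p = 3`, anomalous twist: `MissingPPartAt W 3` and Miller's `BSD(E, 3)` -/

/-- **BOTH halves per pair on the (G-ord, `e = 2`) cell AT `p = 3`, anomalous twist, Keller–Yin-normalised: `MissingPPartAt W 3`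
(`ord₃ #Ш(E)_an = ord₃ #Ш(E)`)** — §1 (lower) and generation 29's UPPER half on the whole cell from the TU datum
(`UpperThreeAnomalousOfPartnerClass.missingUpperBoundAt_gordTwo_three_…`, ⟸ PUB ∪ {[DIV.dvd], CGLS Prop. 14, [RH], [PWL-θ]} ∪ {TU}) through
`missingPPartAt_of_lower_of_upper`.  On the census (1 725 anomalous (G-ord) pairs at `p = 3`) TU is a kit certificate per pair and the normalisation is
certified per pair; class-wide TU is wing r2 (OPEN).  CONDITIONAL; closes no item; BSD not advanced beyond this typed reduction.
[claim: KellerYin2024PotOrd, status: under-review] [cite: Miller2011LMS, Def. 1.1]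
[cite: KellerYin2024b, Thm. 3.3.6 and Prop. 3.4.4 (arXiv:2410.23241 p. 19) (preprint; hypothesis)] [cite: CastellaGrossiLeeSkinner2022, Thms. 2.1.2, 2.2.2, Prop. 14] -/
theorem missingPPartAt_gordTwo_three_anomalous (hF : PrintedFacts)
    (hA : Hsieh2014.thmA_exists_isHsiehLFunction_unrPeriod_anyLevel)
    (hL : LiuZhangZhang2018.thm151_thm153_modularCurve_heegnerVector_additive)
    (hCHσ : castellaHsieh2018_exists_isBranchBDPLFunction_signed)
    (hDVD : thm336_dvd_branch_OPEN) (hAN : thm351_anacong_branch_three_allTwists) (h212 : thm212_exists_isKatzLFunction)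
    (h14 : prop14_residualCharacterSelmer_finite)
    (hRH : thm122_rubinHida_residualPair_unrSelmer) (hPWL : prop125_residualPair_unrSelmer_imprimitive)
    (h331 : thm331_rubin_exists_katzMeasure₂_pseudoIso_span_eq) (h411 : prop411_selmer_isAlmostDivisible)
    (hFE : thmII64_katzMeasure₂_functionalEquation) (hO1 : thmI_mu_katzBranch_reflect_eq_zero)
    (h263 : prop263_sur_of_crk) (h41 : prop41_globalEulerPoincareCorank) (h32 : prop32_cohomology_isCofinitelyGenerated) :
    ∀ (W : WeierstrassCurve ℚ) [W.IsElliptic] [W.IsGloballyMinimal],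
      W.analyticRank = 1 → ClassX3 W 3 → Additive.SubGordTwo W 3 →
      ∀ (V : WeierstrassCurve ℚ) [V.IsElliptic] [V.IsGloballyMinimal] (CV : VariableChange ℚ),
        GoodOrd V 3 → (3 : ℤ) ∣ V.frobeniusTrace 3 - 1 → CV • V.quadraticTwist ((-1 : ℚ) ^ (3 / 2) * (3 : ℕ)) = W →
      (∀ Φ : AddSubgroup (geomTorsion W ((3 : ℕ) : ℤ)), IsRationalLine W 3 Φ → ¬ LineDecompositionTrivialAt W 3 Φ) →
      Upper.TwistUnitFieldOffSliverAt W 3 → MissingPPartAt W 3 :=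
  fun W _ _ hr hX hG V _ _ CV hV ha hCV hnorm hTU =>
    missingPPartAt_of_lower_of_upper W 3
      (missingLowerBoundAt_gordTwo_three_anomalous hF hA hL hCHσ hDVD hAN h212 hRH hPWL h331 h411 hFE hO1 h263 h41 h32 W hr hX hG V CV hV
        ha hCV hnorm)
      (missingUpperBoundAt_gordTwo_three_of_printedFacts_of_twistUnitAt_of_hsieh_of_lzz_of_KY_dvd_of_prop14_of_RH_of_PWL_of_castellaHsieh_signed
        hF hA hL hDVD h14 hCHσ hRH hPWL W hr hX hG hTU)

/-- **Miller's `BSD(E, 3)` per pair on the (G-ord, `e = 2`) cell, anomalous twist, Keller–Yin-normalised** — the previous theorem through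
`bsdp_of_missingPPartAt` (rank = analytic rank and `Ш` finite by GZK, conjunct 3 of `PrintedFacts`).  NOT a proof of BSD for any curve: at each of
the 1 725 anomalous (G-ord) census pairs at `p = 3` it is BSD₃ MODULO {published theorems} ∪ {[DIV.dvd] (preprint), the analytic count (PUB-composed,
audit pending), [RH], [PWL-θ]} ∪ {the pair's TU certificate, the normalised lattice}. [claim: KellerYin2024PotOrd, status: under-review]
[cite: Miller2011LMS, §1 and Def. 1.1] [cite: KellerYin2024b, Thm. 3.3.6 and Prop. 3.4.4 (arXiv:2410.23241 p. 19) (preprint; hypothesis)] -/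
theorem bsdp_gordTwo_three_anomalous (hF : PrintedFacts)
    (hA : Hsieh2014.thmA_exists_isHsiehLFunction_unrPeriod_anyLevel)
    (hL : LiuZhangZhang2018.thm151_thm153_modularCurve_heegnerVector_additive)
    (hCHσ : castellaHsieh2018_exists_isBranchBDPLFunction_signed)
    (hDVD : thm336_dvd_branch_OPEN) (hAN : thm351_anacong_branch_three_allTwists) (h212 : thm212_exists_isKatzLFunction)
    (h14 : prop14_residualCharacterSelmer_finite)
    (hRH : thm122_rubinHida_residualPair_unrSelmer) (hPWL : prop125_residualPair_unrSelmer_imprimitive)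
    (h331 : thm331_rubin_exists_katzMeasure₂_pseudoIso_span_eq) (h411 : prop411_selmer_isAlmostDivisible)
    (hFE : thmII64_katzMeasure₂_functionalEquation) (hO1 : thmI_mu_katzBranch_reflect_eq_zero)
    (h263 : prop263_sur_of_crk) (h41 : prop41_globalEulerPoincareCorank) (h32 : prop32_cohomology_isCofinitelyGenerated) :
    ∀ (W : WeierstrassCurve ℚ) [W.IsElliptic] [W.IsGloballyMinimal],
      W.analyticRank = 1 → ClassX3 W 3 → Additive.SubGordTwo W 3 →
      ∀ (V : WeierstrassCurve ℚ) [V.IsElliptic] [V.IsGloballyMinimal] (CV : VariableChange ℚ),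
        GoodOrd V 3 → (3 : ℤ) ∣ V.frobeniusTrace 3 - 1 → CV • V.quadraticTwist ((-1 : ℚ) ^ (3 / 2) * (3 : ℕ)) = W →
      (∀ Φ : AddSubgroup (geomTorsion W ((3 : ℕ) : ℤ)), IsRationalLine W 3 Φ → ¬ LineDecompositionTrivialAt W 3 Φ) →
      Upper.TwistUnitFieldOffSliverAt W 3 → BSDp W 3 :=
  fun W _ _ hr hX hG V _ _ CV hV ha hCV hnorm hTU =>
    bsdp_of_missingPPartAt W 3 hF.2.2.1 (le_of_eq hr)
      (missingPPartAt_gordTwo_three_anomalous hF hA hL hCHσ hDVD hAN h212 h14 hRH hPWL h331 h411 hFE hO1 h263 h41 h32 W hr hX hG V CV hV ha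
        hCV hnorm hTU)

/-! ### §3 The crux's own currency on the anomalous pairs, and §4 THE WHOLE (G-ord, `e = 2`) CELL AT `p = 3` for Keller–Yin-normalised curves -/

/-- **Crux r3 `GordTwoBranchIMC` (item 19177) AT `p = 3` on the pairs with an ANOMALOUS twist, in the crux's own currency:
`AdditiveIMCLowerBDPInputManinAt W 3`** for every globally minimal `W` with `r_an = 1`, `ClassX3 W 3`, `SubGordTwo W 3`, an anomalous good-ordinary
twist model and the ∀-normalisation ⇐ Kolyvagin ∧ modularity ∧ Hsieh 2014 Thm. A ∧ Liu–Zhang–Zhang 2018 ∧ Castella–Hsieh signed ∧ [DIV.dvd] (PREPRINT) ∧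
the typed hna-free count ∧ CGLS Thm. 2.1.2 ∧ [RH] ∧ [PWL-θ] ∧ the published facts (Greenberg 2006 Prop. 4.2 / §5 A as tree theorems).  FILE 14's
per-datum door at EVERY Heegner datum of the socket; `d_K ≠ −3` is automatic at `p = 3` (`SchneiderFree.sliver_void_at_three`).  The crux itself (all
odd `p`, all pairs, no normalisation binder) stays OPEN.  CONDITIONAL on the displayed named statements; nothing asserted about BSD.
[claim: KellerYin2024PotOrd, status: under-review]
[cite: KellerYin2024b, Thm. 3.3.6, Prop. 3.4.4, Thm. 3.5.1, Assumption 2.0.3 (arXiv:2410.23241 pp. 8, 19–20) (preprint; the Kolyvagin clause a hypothesis)]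
[cite: KellerYin2024, Thms. 1.2.2, 2.2.2, 2.2.3 (arXiv:2402.12781v2)] [cite: CastellaGrossiLeeSkinner2022, Thms. 2.1.2, 2.2.2] [cite: Cox2013, §7.A Lemma 7.5] -/
theorem additiveIMCLowerBDPInputManinAt_gordTwo_three_anomalous
    (hKo : ∀ (N : ℕ) [NeZero N] (W : WeierstrassCurve ℚ) (K : Type) [Field K] [NumberField K],
      Literature.NumberTheory.EllipticCurves.kolyvagin N W K)
    (hPar : nonempty_modularParametrizationData)
    (hA : Hsieh2014.thmA_exists_isHsiehLFunction_unrPeriod_anyLevel)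
    (hL : LiuZhangZhang2018.thm151_thm153_modularCurve_heegnerVector_additive)
    (hCHσ : castellaHsieh2018_exists_isBranchBDPLFunction_signed)
    (hDVD : thm336_dvd_branch_OPEN) (hAN : thm351_anacong_branch_three_allTwists) (h212 : thm212_exists_isKatzLFunction)
    (hRH : thm122_rubinHida_residualPair_unrSelmer) (hPWL : prop125_residualPair_unrSelmer_imprimitive)
    (h331 : thm331_rubin_exists_katzMeasure₂_pseudoIso_span_eq) (h411 : prop411_selmer_isAlmostDivisible)
    (hFE : thmII64_katzMeasure₂_functionalEquation) (hO1 : thmI_mu_katzBranch_reflect_eq_zero)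
    (h263 : prop263_sur_of_crk) (h41 : prop41_globalEulerPoincareCorank) (h32 : prop32_cohomology_isCofinitelyGenerated) :
    ∀ (W : WeierstrassCurve ℚ) [W.IsElliptic] [W.IsGloballyMinimal],
      W.analyticRank = 1 → ClassX3 W 3 → Additive.SubGordTwo W 3 →
      ∀ (V : WeierstrassCurve ℚ) [V.IsElliptic] [V.IsGloballyMinimal] (CV : VariableChange ℚ),
        GoodOrd V 3 → (3 : ℤ) ∣ V.frobeniusTrace 3 - 1 → CV • V.quadraticTwist ((-1 : ℚ) ^ (3 / 2) * (3 : ℕ)) = W →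
      (∀ Φ : AddSubgroup (geomTorsion W ((3 : ℕ) : ℤ)), IsRationalLine W 3 Φ → ¬ LineDecompositionTrivialAt W 3 Φ) →
      AdditiveIMCLowerBDPInputManinAt W 3 := by
  intro W _ _ hr hX hS V _ _ CV hV ha hCV hnorm N _ K _ _ Dt H ι P hr' hloc hN hK hodd hunit hHe hL1 hP hnt κ hκ γ _ 𝔭 h𝔭 he hf
  -- the `d_K = −3` sliver is void at `p = 3`
  have hdK : NumberField.discr K ≠ -3 := fun hd ↦ sliver_void_at_three hK hd rfl hunit
  exact additiveIMCLowerBDPOnTree_subGordTwo_three_offSliver_anomalous_self hKo hPar hA hL hCHσ hDVD hAN h212 hRH hPWL h331 h411 hFE hO1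
    h263 h41 Greenberg2006.prop42_localEulerPoincareCorank_holds Greenberg2006.sec5A_localH2_subsingleton_of_LOC1_holds h32 W hr hX hS V CV hV
    ha hCV hnorm N K Dt H ι P hr' hloc hN hK hodd hunit hHe hL1 hP hnt hdK κ hκ γ 𝔭 h𝔭 he hf

/-- **THE WHOLE (G-ord, `e = 2`) CELL AT `p = 3`: crux r3's conclusion `AdditiveIMCLowerBDPInputManinAt W 3` for EVERY globally minimal Keller–Yin-normalised
curve of the cell with `r_an = 1`** — `ClassX3 W 3`, `SubGordTwo W 3` and the ∀-normalisation «every rational `3`-line of `W` is `D₃`-non-trivial»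
(Keller–Yin 2410.23241's standing choice of lattice; AUTOMATIC on the 686 NAT pairs, a choice within the isogeny class on the 1 725 anomalous ones) ⇐
Kolyvagin ∧ modularity ∧ Hsieh A ∧ LZZ ∧ Castella–Hsieh signed ∧ [DIV.dvd] ∧ BOTH typed analytic counts ([AN3] and its hna-free form) ∧ [BR3] ∧ CGLS
Thm. 2.1.2, Props. 1.2.5, 14, Cor. 1.2.6 ×2 ∧ [RH] ∧ [PWL-θ] ∧ Greenberg ×4 (+2 tree theorems) ∧ Bleher et al. ∧ de Shalit ∧ Hida.  By the dichotomy
`forall_twist_not_anomalous_or_exists_anomalous_twist`: generation 27's `KYBranchThreePerPair.…_of_print_of_forall_twist_tenFacts` on the NAT branch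
(the normalisation is not used there), §3 on the anomalous branch.  CONDITIONAL; the crux (no normalisation binder, all odd `p`) stays OPEN; BSD not
advanced. [claim: KellerYin2024PotOrd, status: under-review]
[cite: KellerYin2024b, Assumption 2.0.3 / §3.3 standing normalisation, Thm. 3.3.6, Prop. 3.4.4, Thm. 3.5.1 (arXiv:2410.23241 pp. 8, 19–20) (preprint)]
[cite: CastellaGrossiLeeSkinner2022, Thms. 1.2.2, 2.1.2, 2.2.2, Prop. 14] [cite: KellerYin2024, Thms. 1.2.2, 2.2.2, 2.2.3 (arXiv:2402.12781v2)] -/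
theorem additiveIMCLowerBDPInputManinAt_gordTwo_three_of_normalised
    (hKo : ∀ (N : ℕ) [NeZero N] (W : WeierstrassCurve ℚ) (K : Type) [Field K] [NumberField K],
      Literature.NumberTheory.EllipticCurves.kolyvagin N W K)
    (hPar : nonempty_modularParametrizationData)
    (hA : Hsieh2014.thmA_exists_isHsiehLFunction_unrPeriod_anyLevel)
    (hL : LiuZhangZhang2018.thm151_thm153_modularCurve_heegnerVector_additive)
    (hCHσ : castellaHsieh2018_exists_isBranchBDPLFunction_signed)
    (hDVD : thm336_dvd_branch_OPEN) (hAN3 : thm351_anacong_branch_three) (hAN : thm351_anacong_branch_three_allTwists)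
    (hBR : thm122_charLambda_pair_three) (h212 : thm212_exists_isKatzLFunction)
    (hprop125 : prop125_characterGrSelmerDual_torsion_muZero_dim) (hfact : prop14_residualCharacterSelmer_finite)
    (hlift : cor126_residualCharacter_globalLift) (hlocal : cor126_residualCharacter_localSurjective)
    (hRH : thm122_rubinHida_residualPair_unrSelmer) (hPWL : prop125_residualPair_unrSelmer_imprimitive)
    (h331 : thm331_rubin_exists_katzMeasure₂_pseudoIso_span_eq) (h411 : prop411_selmer_isAlmostDivisible)
    (hFE : thmII64_katzMeasure₂_functionalEquation) (hO1 : thmI_mu_katzBranch_reflect_eq_zero)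
    (h263 : prop263_sur_of_crk) (h41 : prop41_globalEulerPoincareCorank) (h32 : prop32_cohomology_isCofinitelyGenerated) :
    ∀ (W : WeierstrassCurve ℚ) [W.IsElliptic] [W.IsGloballyMinimal],
      W.analyticRank = 1 → ClassX3 W 3 → Additive.SubGordTwo W 3 →
      (∀ Φ : AddSubgroup (geomTorsion W ((3 : ℕ) : ℤ)), IsRationalLine W 3 Φ → ¬ LineDecompositionTrivialAt W 3 Φ) →
      AdditiveIMCLowerBDPInputManinAt W 3 := by
  intro W _ _ hr hX hS hnorm
  rcases forall_twist_not_anomalous_or_exists_anomalous_twist W hX hS with hNAT | ⟨V, _, _, C, hV, hC, ha⟩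
  · exact KYBranchThreePerPair.additiveIMCLowerBDPInputManinAt_gordTwo_three_of_print_of_forall_twist_tenFacts hKo hPar hA hL hCHσ hDVD hAN3
      hBR h212 hprop125 hfact hlift hlocal h411 h263 h41 h32 W hr hX hS hNAT
  · have hC' : C • V.quadraticTwist ((-1 : ℚ) ^ (3 / 2) * (3 : ℕ)) = W := by
      rw [show ((-1 : ℚ) ^ (3 / 2) * (3 : ℕ) : ℚ) = -3 by norm_num]; exact hC
    exact additiveIMCLowerBDPInputManinAt_gordTwo_three_anomalous hKo hPar hA hL hCHσ hDVD hAN h212 hRH hPWL h331 h411 hFE hO1 h263 h41 h32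
      W hr hX hS V C hV ha hC' hnorm

end Summit.BirchSwinnertonDyer.BirchSwinnertonDyer.Theorems.SchneiderFreeAdditiveX3.KYBranchThreeAnomalousPerPair

end
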